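import Literature.Analysis.FluidPDE.BesovDuhamelEstimates
import Literature.Analysis.FluidPDE.BesovMildAssembly
import Literature.Analysis.FluidPDE.KatoMildContinuity
import Literature.Analysis.FluidPDE.KatoUniquenessDual
import Literature.Analysis.FunctionSpaces.LittlewoodPaleyHeatContinuity
import HarnessLib

/-!
# Besov regularity and time continuity of the Navier–Stokes Duhamel term; BCD Theorem 5.40 holds

Analysis/FluidPDE proof file (no definitions, no named facts). It **discharges the named fact**
`Literature.Analysis.FluidPDE.exists_isBesovMildSolutionOn` (Bahouri–Chemin–Danchin 2011,
Thm. 5.40: local well-posedness of the Navier–Stokes equations for divergence-free data in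
`Ḃ^{-1+3/p}_{p,q}(ℝ³)`, `3 < p, q < ∞`, with a mild solution in `C([0,T]; Ḃ^{-1+3/p}_{p,q})`):
`exists_isBesovMildSolutionOn_holds`, the last theorem of the file. The assembly
`exists_isBesovMildSolutionOn_of_duhamel` (`BesovMildAssembly.lean`: Kato's fixed point in the
`L^p`-weighted class, the free evolution, the realisation dictionary) reduced the fact to one
analytic input, proved here: **the Duhamel term `B(u,u)(t) = ∫₀ᵗ e^{(t-s)Δ}ℙ∇·(u⊗u)(s) ds` of an
arbitrary jointly measurable field with Kato bounds `‖u(t)‖_{L^p} ≤ a t^{-(1-3/p)/2}`,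
`|u(t)(x)| ≤ b t^{-1/2}` on `(0,T)` is an `L^p` function whose tempered distribution is bounded by
`C a b` in `Ḃ^{-1+3/p}_{p,1}` and continuous in time on `(0,T)` in that norm** (`besov_duhamel_of_kato`;
Gallagher–Koch–Planchon 2016, App. B; BCD, proof of Thm. 5.40), on top of the Littlewood–Paley
analysis of the Oseen kernel of `OseenKernelBlocks.lean`, `BesovDuhamelBlocks.lean`,
`BesovDuhamelEstimates.lean`:

* `§ KatoProfile` — the block profile
  `2^{j(-1+3/p)}‖Δ̇_j B(u,u)(t)‖_{L^p} ≤ K a b min((4^jt)^{3/(4p)}, (4^jt)^{-(1-3/(2p))})`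
  (`exists_lpBlockWeight_kochTataruBilinear_profile`: low frequencies by the vanishing mean of the
  kernel, gain `2^{jγ}`, `γ = 1 - 3/(2p)`; high frequencies by the heat structure `e^{-c(t-s)4^j}`;
  data through Kato's weight `‖|u(s)||u(s)|‖_{L^p} ≤ ab s^{-γ}`), `B(u,u)(t) ∈ L^p`
  (`memLp_kochTataruBilinear_of_kato`, Minkowski), and the `Ḃ^{-1+3/p}_{p,1}` bound `C a b` of every
  distribution it defines (`exists_besov_bound_kochTataruBilinear`, the dyadic sums being bounded
  uniformly in `t`, `exists_tsum_dyadic_profile_le`);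
* `§ ShortPiece` — the same profile for the short pieces `∫_{t₀}^t …` with the small factor
  `(t-t₀)^γ` (`exists_lpBlockWeight_oseenDuhamel_one_profile`) and the **restart identity**
  `B(u,u)(t) = e^{(t-t₀)Δ}B(u,u)(t₀) + ∫_{t₀}^t e^{(t-s)Δ}ℙ∇·(u⊗u)(s) ds` for global Kato fields
  (`kochTataruBilinear_eq_heatExtension_add_oseenDuhamel`, through Koch–Tataru's path space:
  `KatoLp.eKochTataruNorm_lt_top_of_kato_bounds` and `heatExtension_kochTataruBilinear_eq`);
* `§ Continuity` — continuity at `t₀ ∈ (0, ∞)` of `t ↦ V(t)` in `Ḃ^{-1+3/p}_{p,1}`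
  (`exists_besov_duhamel_of_global_kato`): `V(t) - V(t₀) = (e^{(t-t₀)Δ} - 1)V(t₀) + short piece`
  for `t > t₀`, the first term `→ 0` by the strong continuity of the heat semigroup on one element
  (`MemHomBesov.tendsto_eHomBesovNorm_heatSemigroup_sub_self`) and, for `t < t₀`, uniformly over
  the profile-dominated family `{V(t)}_{t ∈ [t₀/2,t₀]}`
  (`eventually_eHomBesovNorm_heatSemigroup_sub_le_of_profile`, `LittlewoodPaleyHeatContinuity.lean`);
  the local-in-time statement `besov_duhamel_of_kato` (= hypothesis `h5` of
  `exists_isBesovMildSolutionOn_of_duhamel`) by the time cut-off `1_{(-∞,T)}u`; and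
  `exists_isBesovMildSolutionOn_holds`.

## References

* H. Bahouri, J.-Y. Chemin, R. Danchin, *Fourier Analysis and Nonlinear PDE*, Grundlehren 343
  (2011), Thm. 5.40 (and its proof), Lemma 2.4. [BahouriCheminDanchin2011]
* I. Gallagher, G. S. Koch, F. Planchon, *Blow-up of critical Besov norms at a potential
  Navier–Stokes singularity*, Comm. Math. Phys. 343 (2016) = arXiv:1407.4156, App. B. [GKP2016]
* T. Kato, *Strong `L^p`-solutions of the Navier–Stokes equation in `ℝ^m`*, Math. Z. 187 (1984),
  §2. [Kato1984]
* P. G. Lemarié-Rieusset, *The Navier–Stokes Problem in the 21st Century* (2016), Thm. 6.1,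
  Thm. 9.1. [LemarieRieusset2016]
-/

noncomputable section

open MeasureTheory Set Function Filter
open _root_.Topology
open scoped SchwartzMap ENNReal NNReal RealInnerProductSpace Convolution

namespace Literature.Analysis.FluidPDE

open FunctionSpaces (blockFn blockKernel)


/-! ## The block profile of the Duhamel term of a Kato-class field on `ℝ³` -/

section KatoProfile

/-- Local notation for physical space `ℝ³ = EuclideanSpace ℝ (Fin 3)`. -/
local notation "ℝ³" => EuclideanSpace ℝ (Fin 3)

/-- **Kato's product weight**: if `‖u(s)‖_{L^p} ≤ a s^{-α}` and `|u(s)(y)| ≤ b s^{-1/2}` then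
`‖ |u(s)| |u(s)| ‖_{L^p} ≤ a b s^{-(α + 1/2)}`. [cite: Kato1984, §2 (2.1)–(2.2)] -/
private theorem eLpNorm_norm_mul_norm_le_kato' {X : Type*} [MeasurableSpace X] {μ : Measure X}
    {F : Type*} [NormedAddCommGroup F] {f : X → F} {p : ℝ≥0∞} {A B : ℝ} (hA : eLpNorm f p μ ≤ ENNReal.ofReal A)
    (hB0 : 0 ≤ B) (hB : ∀ y, ‖f y‖ ≤ B) :
    eLpNorm (fun y => ‖f y‖ * ‖f y‖) p μ ≤ ENNReal.ofReal (A * B) := by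
  have hpt : ∀ y, ‖(‖f y‖ * ‖f y‖)‖ ≤ ‖(B • fun y => ‖f y‖) y‖ := by
    intro y
    simp only [Pi.smul_apply, smul_eq_mul, Real.norm_eq_abs, abs_mul, abs_norm, abs_of_nonneg hB0]
    rw [mul_comm]
    exact mul_le_mul_of_nonneg_right (hB y) (norm_nonneg _)
  calc eLpNorm (fun y => ‖f y‖ * ‖f y‖) p μ ≤ eLpNorm (B • fun y => ‖f y‖) p μ := eLpNorm_mono hpt
    _ = ‖B‖ₑ * eLpNorm (fun y => ‖f y‖) p μ := eLpNorm_const_smul B _ p μ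
    _ = ENNReal.ofReal B * eLpNorm f p μ := by rw [Real.enorm_eq_ofReal hB0, eLpNorm_norm]
    _ ≤ ENNReal.ofReal B * ENNReal.ofReal A := mul_le_mul_right hA _
    _ = ENNReal.ofReal (A * B) := by rw [← ENNReal.ofReal_mul hB0, mul_comm]

/-- Real exponent bookkeeping of the critical theory: with `pr > 3`, `s = -1 + 3/pr`,
`γ = 1 - 3/(2pr)`: `0 < γ < 1`, `(γ+1)/2 - γ = 3/(4pr) = (s+γ)/2`, `1/2 - γ = s/2`, `(s-1)/2 = -γ`,
`s/2 + γ = 1/2`. [folklore] -/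
theorem critical_exponents {pr : ℝ} (hpr : 3 < pr) :
    0 < 1 - 3 / (2 * pr) ∧ 1 - 3 / (2 * pr) < 1 ∧ 0 < 3 / (4 * pr) ∧
      (1 - 3 / (2 * pr) + 1) / 2 - (1 - 3 / (2 * pr)) = 3 / (4 * pr) ∧
      ((-1 + 3 / pr) + (1 - 3 / (2 * pr))) / 2 = 3 / (4 * pr) ∧
      (1 : ℝ) / 2 - (1 - 3 / (2 * pr)) = (-1 + 3 / pr) / 2 ∧
      ((-1 + 3 / pr) - 1) / 2 = -(1 - 3 / (2 * pr)) ∧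
      (-1 + 3 / pr) / 2 + (1 - 3 / (2 * pr)) = 1 / 2 := by
  have hpr0 : 0 < pr := by linarith
  have h1 : 3 / (2 * pr) < 1 := by rw [div_lt_one (by positivity)]; linarith
  have h2 : 0 < 3 / (2 * pr) := by positivity
  refine ⟨by linarith, by linarith, by positivity, ?_, ?_, ?_, ?_, ?_⟩ <;> field_simp <;> ring

variable {p : ℝ≥0∞} [hp1 : Fact (1 ≤ p)]

/-- **The block profile of the Duhamel term of a Kato-class field** (GKP 2016, App. B; BCD, proof of
Thm. 5.40): for `3 < p < ∞` there is `K` such that for every jointly measurable `u` with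
`‖u(t)‖_{L^p} ≤ a t^{-(1-3/p)/2}` and `|u(t)(x)| ≤ b t^{-1/2}` on `(0, T)`, every `t ∈ (0,T)` and `j ∈ ℤ`,
`2^{j(-1+3/p)} ‖Δ̇_j B(u,u)(t)‖_{L^p} ≤ K a b · min((4^jt)^{3/(4p)}, (4^jt)^{-(1-3/(2p))})` — the low
frequencies by the vanishing mean of the kernel (gain `2^{jγ}`, `γ = 1 - 3/(2p)`), the high frequencies
by the heat structure (`e^{-c(t-s)4^j}`), the data entering through Kato's weight
`‖|u(s)||u(s)|‖_{L^p} ≤ a b s^{-γ}`. [cite: GKP2016, App. B] -/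
theorem exists_lpBlockWeight_kochTataruBilinear_profile (hp₃ : 3 < p) (hp : p < ∞) :
    ∃ K : ℝ, 0 ≤ K ∧ ∀ ⦃u : ℝ → ℝ³ → ℝ³⦄ ⦃T a b : ℝ⦄, Measurable (uncurry u) → 0 ≤ a → 0 ≤ b →
      (∀ t ∈ Ioo 0 T, eLpNorm (u t) p volume ≤
          ENNReal.ofReal (a * t ^ (-((1 - 3 / p.toReal) / 2)))) →
      (∀ t ∈ Ioo 0 T, ∀ x, ‖u t x‖ ≤ b * t ^ (-(1 / 2 : ℝ))) →
      ∀ t ∈ Ioo 0 T, ∀ j : ℤ,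
        (2 : ℝ≥0∞) ^ ((j : ℝ) * (-1 + 3 / p.toReal)) * eLpNorm (blockFn j (kochTataruBilinear u u t)) p volume ≤
          ENNReal.ofReal (K * a * b * min (((4 : ℝ) ^ j * t) ^ (3 / (4 * p.toReal)))
            (((4 : ℝ) ^ j * t) ^ (-(1 - 3 / (2 * p.toReal))))) := by
  -- ### exponents
  have hptop : p ≠ ∞ := hp.ne
  have hpr : (3 : ℝ) < p.toReal := by
    have h := ENNReal.toReal_strict_mono hptop hp₃; simpa using h
  set pr : ℝ := p.toReal with hprdef
  obtain ⟨hγ0, hγ1, ha'0, hLexp, hsγ, hhalf, hs1, hsγ2⟩ := critical_exponents hpr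
  set γ : ℝ := 1 - 3 / (2 * pr) with hγ
  set s : ℝ := -1 + 3 / pr with hsdef
  set a' : ℝ := 3 / (4 * pr) with ha'
  have hαγ : -((1 - 3 / pr) / 2) + -(1 / 2 : ℝ) = -γ := by rw [hγ]; ring
  -- ### the constants
  obtain ⟨CL, hCL0, hCL⟩ := exists_lintegral_majorant_le_low (E := ℝ³) hγ0.le hγ1
  obtain ⟨CH, c, hCH0, hc, hCH⟩ := exists_lintegral_majorant_le_high (ι := Fin 3)
  set I : ℝ := ∫ r in (0 : ℝ)..1, (1 - r) ^ (-((1 - γ) / 2)) * r ^ (-γ) with hI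
  have hI0 : 0 ≤ I := integral_one_sub_rpow_mul_rpow_nonneg _ _
  obtain ⟨M', hM'0, hM'⟩ := FunctionSpaces.exists_rpow_mul_exp_neg_mul_le (a := (1 / 2 : ℝ)) (κ := c / 2)
    (by norm_num) (half_pos hc)
  set K₁ : ℝ := CL * I with hK₁
  set K₂ : ℝ := CH * (2 : ℝ) ^ (-(s / 2)) / (1 - γ) with hK₂
  set K₃ : ℝ := CH * (Real.sqrt Real.pi * c ^ (-(1 / 2 : ℝ)) * (2 : ℝ) ^ γ) with hK₃
  have hK₁0 : 0 ≤ K₁ := by positivity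
  have hK₂0 : 0 ≤ K₂ := by rw [hK₂]; exact div_nonneg (by positivity) (by linarith)
  have hK₃0 : 0 ≤ K₃ := by have := Real.rpow_nonneg hc.le (-(1 / 2 : ℝ)); positivity
  refine ⟨max K₁ (K₂ * M' + K₃), le_max_of_le_left hK₁0, ?_⟩
  intro u T a b hum ha hb hLp hinf t ht j
  have ht0 : 0 < t := ht.1
  set x : ℝ := (4 : ℝ) ^ j * t with hx
  have hx0 : 0 < x := by positivity
  have h4 : ((4 : ℝ) ^ j) = (2 : ℝ) ^ (2 * j) := by rw [zpow_mul]; norm_num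
  have h2j : ∀ e : ℝ, (2 : ℝ) ^ ((j : ℝ) * e) = ((4 : ℝ) ^ j) ^ (e / 2) := by
    intro e
    rw [h4, ← Real.rpow_intCast, ← Real.rpow_mul zero_le_two]
    push_cast; ring_nf
  -- ### Kato's weight and the Minkowski bound
  have hN : ∀ τ ∈ Ioo 0 t, eLpNorm (fun y => ‖u τ y‖ * ‖u τ y‖) p volume ≤
      ENNReal.ofReal (a * b * τ ^ (-γ)) := by
    intro τ hτ
    have hτT : τ ∈ Ioo 0 T := ⟨hτ.1, hτ.2.trans ht.2⟩
    have hB0 : 0 ≤ b * τ ^ (-(1 / 2 : ℝ)) := mul_nonneg hb (Real.rpow_nonneg hτ.1.le _)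
    have h := eLpNorm_norm_mul_norm_le_kato' (hLp τ hτT) hB0 (hinf τ hτT)
    refine h.trans (le_of_eq ?_)
    congr 1
    rw [show a * τ ^ (-((1 - 3 / pr) / 2)) * (b * τ ^ (-(1 / 2 : ℝ))) =
      a * b * (τ ^ (-((1 - 3 / pr) / 2)) * τ ^ (-(1 / 2 : ℝ))) by ring, ← Real.rpow_add hτ.1, hαγ]
  have hNi : IntegrableOn (fun τ => (t - τ) ^ (-(1 / 2 : ℝ)) * (a * b * τ ^ (-γ))) (Ioo 0 t) := by
    have h := (intervalIntegrable_sub_rpow_mul_rpow (a := 1 / 2) (b := γ) (by norm_num) (by norm_num)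
      hγ0.le hγ1 ht0).const_mul (a * b)
    rw [intervalIntegrable_iff_integrableOn_Ioo_of_le ht0.le] at h
    refine h.congr_fun (fun τ _ => by ring) measurableSet_Ioo
  have hMink := eLpNorm_blockFn_kochTataruBilinear_le j hum hum
    (Mu := fun τ => b * τ ^ (-(1 / 2 : ℝ))) (Mv := fun τ => b * τ ^ (-(1 / 2 : ℝ))) (N := fun τ => a * b * τ ^ (-γ))
    (fun τ hτ y => hinf τ ⟨hτ.1, hτ.2.trans ht.2⟩ y) (fun τ hτ y => hinf τ ⟨hτ.1, hτ.2.trans ht.2⟩ y)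
    hp1.out hptop hN (fun τ hτ => by have := Real.rpow_nonneg hτ.1.le (-γ); positivity) hNi
  -- ### the two regimes
  have hlow : eLpNorm (blockFn j (kochTataruBilinear u u t)) p volume ≤
      ENNReal.ofReal (CL * (a * b) * I * (2 : ℝ) ^ ((j : ℝ) * γ) * t ^ ((γ + 1) / 2 - γ)) := by
    refine hMink.trans ?_
    calc ∫⁻ τ in Ioo 0 t, (∫⁻ y, ‖∑ k, ∑ l, ‖blockFn j (fun w => oseenKernel (t - τ) w
            (stdOrthonormalBasis ℝ ℝ³ k) (stdOrthonormalBasis ℝ ℝ³ l)) y‖‖ₑ) * ENNReal.ofReal (a * b * τ ^ (-γ))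
        ≤ ∫⁻ τ in Ioo 0 t, ENNReal.ofReal (CL * (2 : ℝ) ^ ((j : ℝ) * γ) * (t - τ) ^ ((γ - 1) / 2)) *
            ENNReal.ofReal (a * b * τ ^ (-γ)) :=
          setLIntegral_mono' measurableSet_Ioo fun τ hτ =>
            mul_le_mul_left (hCL j (sub_pos.2 hτ.2)) _
      _ = _ := lintegral_Ioo_low_kato hγ0.le hγ1 hγ0.le hγ1 hCL0 (by positivity) ht0 j
  have hhigh : eLpNorm (blockFn j (kochTataruBilinear u u t)) p volume ≤
      ENNReal.ofReal (CH * (a * b) * (Real.exp (-(c * (t / 2) * 2 ^ (2 * j))) * (t / 2) ^ (-(1 / 2 : ℝ)) *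
        ((t / 2) ^ (1 - γ) / (1 - γ)) +
        (t / 2) ^ (-γ) * (Real.sqrt Real.pi * (c * 2 ^ (2 * j)) ^ (-(1 / 2 : ℝ))))) := by
    refine hMink.trans ?_
    calc ∫⁻ τ in Ioo 0 t, (∫⁻ y, ‖∑ k, ∑ l, ‖blockFn j (fun w => oseenKernel (t - τ) w
            (stdOrthonormalBasis ℝ ℝ³ k) (stdOrthonormalBasis ℝ ℝ³ l)) y‖‖ₑ) * ENNReal.ofReal (a * b * τ ^ (-γ))
        ≤ ∫⁻ τ in Ioo 0 t, ENNReal.ofReal (CH * Real.exp (-(c * (t - τ) * 2 ^ (2 * j))) *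
            (t - τ) ^ (-(1 / 2 : ℝ))) * ENNReal.ofReal (a * b * τ ^ (-γ)) :=
          setLIntegral_mono' measurableSet_Ioo fun τ hτ =>
            mul_le_mul_left (hCH j (sub_pos.2 hτ.2)) _
      _ ≤ _ := lintegral_Ioo_high_kato_le hc hγ0.le hγ1 hCH0 (by positivity) ht0 j
  -- ### the profile
  have hw : (2 : ℝ≥0∞) ^ ((j : ℝ) * s) = ENNReal.ofReal ((2 : ℝ) ^ ((j : ℝ) * s)) := by
    rw [← ENNReal.ofReal_ofNat 2, ENNReal.ofReal_rpow_of_pos two_pos]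
  -- low regime as a function of `x`
  have hlow' : (2 : ℝ≥0∞) ^ ((j : ℝ) * s) * eLpNorm (blockFn j (kochTataruBilinear u u t)) p volume ≤
      ENNReal.ofReal (K₁ * a * b * x ^ a') := by
    rw [hw]
    refine (mul_le_mul_right hlow _).trans (le_of_eq ?_)
    rw [← ENNReal.ofReal_mul (Real.rpow_nonneg zero_le_two _)]
    congr 1
    have hprod : (2 : ℝ) ^ ((j : ℝ) * s) * ((2 : ℝ) ^ ((j : ℝ) * γ) * t ^ ((γ + 1) / 2 - γ)) = x ^ a' := by
      rw [hLexp, ← mul_assoc, ← Real.rpow_add two_pos, show (j : ℝ) * s + (j : ℝ) * γ = (j : ℝ) * (s + γ) by ring,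
        h2j, show (s + γ) / 2 = a' by rw [← hsγ], hx,
        Real.mul_rpow (zpow_nonneg (by norm_num) _) ht0.le]
    calc (2 : ℝ) ^ ((j : ℝ) * s) * (CL * (a * b) * I * (2 : ℝ) ^ ((j : ℝ) * γ) * t ^ ((γ + 1) / 2 - γ))
        = CL * (a * b) * I * ((2 : ℝ) ^ ((j : ℝ) * s) * ((2 : ℝ) ^ ((j : ℝ) * γ) * t ^ ((γ + 1) / 2 - γ))) := by
          ring
      _ = K₁ * a * b * x ^ a' := by rw [hprod, hK₁]; ring
  -- high regime as a function of `x`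
  have hhigh' : (2 : ℝ≥0∞) ^ ((j : ℝ) * s) * eLpNorm (blockFn j (kochTataruBilinear u u t)) p volume ≤
      ENNReal.ofReal (a * b * (K₂ * (x ^ (s / 2) * Real.exp (-(c / 2) * x)) + K₃ * x ^ (-γ))) := by
    rw [hw]
    refine (mul_le_mul_right hhigh _).trans (le_of_eq ?_)
    rw [← ENNReal.ofReal_mul (Real.rpow_nonneg zero_le_two _)]
    congr 1
    have ht2 : 0 < t / 2 := half_pos ht0
    -- `2^{js} (t/2)^{-1/2} (t/2)^{1-γ} = 2^{-s/2} x^{s/2}`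
    have e1 : (2 : ℝ) ^ ((j : ℝ) * s) * ((t / 2) ^ (-(1 / 2 : ℝ)) * (t / 2) ^ (1 - γ)) =
        (2 : ℝ) ^ (-(s / 2)) * x ^ (s / 2) := by
      rw [← Real.rpow_add ht2, show -(1 / 2 : ℝ) + (1 - γ) = 1 / 2 - γ by ring, hhalf, h2j,
        hx, Real.mul_rpow (zpow_nonneg (by norm_num) _) ht0.le,
        Real.div_rpow ht0.le zero_le_two, Real.rpow_neg zero_le_two]
      have h2s : (2 : ℝ) ^ (s / 2) ≠ 0 := (Real.rpow_pos_of_pos two_pos _).ne'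
      field_simp
    -- `2^{js} (t/2)^{-γ} (2^{2j})^{-1/2} = 2^γ x^{-γ}`
    have e2 : (2 : ℝ) ^ ((j : ℝ) * s) * ((t / 2) ^ (-γ) * (c * (2 : ℝ) ^ (2 * j)) ^ (-(1 / 2 : ℝ))) =
        c ^ (-(1 / 2 : ℝ)) * (2 : ℝ) ^ γ * x ^ (-γ) := by
      have hpow : ((4 : ℝ) ^ j) ^ (s / 2) * ((4 : ℝ) ^ j) ^ (-(1 / 2 : ℝ)) = ((4 : ℝ) ^ j) ^ (-γ) := by
        rw [← Real.rpow_add (zpow_pos (by norm_num) _), ← hs1]; congr 1; ring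
      have hxγ : x ^ (-γ) = ((4 : ℝ) ^ j) ^ (-γ) * t ^ (-γ) := by
        rw [hx, Real.mul_rpow (zpow_nonneg (by norm_num) _) ht0.le]
      calc (2 : ℝ) ^ ((j : ℝ) * s) * ((t / 2) ^ (-γ) * (c * (2 : ℝ) ^ (2 * j)) ^ (-(1 / 2 : ℝ)))
          = ((4 : ℝ) ^ j) ^ (s / 2) * ((t ^ (-γ) * (2 : ℝ) ^ γ) *
              (c ^ (-(1 / 2 : ℝ)) * ((4 : ℝ) ^ j) ^ (-(1 / 2 : ℝ)))) := by
            rw [Real.mul_rpow hc.le (zpow_nonneg (by norm_num) _), ← h4, h2j,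
              Real.div_rpow ht0.le zero_le_two, Real.rpow_neg zero_le_two, div_inv_eq_mul]
        _ = c ^ (-(1 / 2 : ℝ)) * (2 : ℝ) ^ γ * (t ^ (-γ) * (((4 : ℝ) ^ j) ^ (s / 2) * ((4 : ℝ) ^ j) ^ (-(1 / 2 : ℝ)))) := by
            ring
        _ = c ^ (-(1 / 2 : ℝ)) * (2 : ℝ) ^ γ * x ^ (-γ) := by rw [hpow, hxγ]; ring
    have hexp : Real.exp (-(c * (t / 2) * (2 : ℝ) ^ (2 * j))) = Real.exp (-(c / 2) * x) := by
      congr 1; rw [hx, h4]; ring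
    calc (2 : ℝ) ^ ((j : ℝ) * s) * (CH * (a * b) * (Real.exp (-(c * (t / 2) * 2 ^ (2 * j))) *
          (t / 2) ^ (-(1 / 2 : ℝ)) * ((t / 2) ^ (1 - γ) / (1 - γ)) +
          (t / 2) ^ (-γ) * (Real.sqrt Real.pi * (c * 2 ^ (2 * j)) ^ (-(1 / 2 : ℝ)))))
        = CH * (a * b) * (Real.exp (-(c * (t / 2) * 2 ^ (2 * j))) / (1 - γ) *
            ((2 : ℝ) ^ ((j : ℝ) * s) * ((t / 2) ^ (-(1 / 2 : ℝ)) * (t / 2) ^ (1 - γ))) +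
            Real.sqrt Real.pi * ((2 : ℝ) ^ ((j : ℝ) * s) * ((t / 2) ^ (-γ) * (c * 2 ^ (2 * j)) ^ (-(1 / 2 : ℝ))))) := by
          ring
      _ = a * b * (K₂ * (x ^ (s / 2) * Real.exp (-(c / 2) * x)) + K₃ * x ^ (-γ)) := by
          rw [e1, e2, hexp, hK₂, hK₃]; ring
  -- ### conclusion: the minimum of the two regimes
  have hab : 0 ≤ a * b := mul_nonneg ha hb
  rcases le_or_gt 1 x with hx1 | hx1
  · -- `x ≥ 1`: both bounds available; `x^{s/2} e^{-cx/2} = x^{-γ} (x^{1/2} e^{-cx/2}) ≤ M' x^{-γ}`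
    have hdecay : x ^ (s / 2) * Real.exp (-(c / 2) * x) ≤ M' * x ^ (-γ) := by
      have hsp : x ^ (s / 2) = x ^ (-γ) * x ^ (1 / 2 : ℝ) := by
        rw [← Real.rpow_add hx0]; congr 1; linarith [hsγ2]
      rw [hsp, mul_assoc, mul_comm M']
      exact mul_le_mul_of_nonneg_left (hM' x hx0.le) (Real.rpow_nonneg hx0.le _)
    have hmin : min (x ^ a') (x ^ (-γ)) = x ^ (-γ) := by
      refine min_eq_right ?_
      calc x ^ (-γ) ≤ x ^ (0 : ℝ) := Real.rpow_le_rpow_of_exponent_le hx1 (by linarith)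
        _ ≤ x ^ a' := Real.rpow_le_rpow_of_exponent_le hx1 ha'0.le
    rw [hmin]
    refine hhigh'.trans (ENNReal.ofReal_le_ofReal ?_)
    calc a * b * (K₂ * (x ^ (s / 2) * Real.exp (-(c / 2) * x)) + K₃ * x ^ (-γ))
        ≤ a * b * (K₂ * (M' * x ^ (-γ)) + K₃ * x ^ (-γ)) := by gcongr
      _ = (K₂ * M' + K₃) * a * b * x ^ (-γ) := by ring
      _ ≤ max K₁ (K₂ * M' + K₃) * a * b * x ^ (-γ) :=
          mul_le_mul_of_nonneg_right (mul_le_mul_of_nonneg_right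
            (mul_le_mul_of_nonneg_right (le_max_right _ _) ha) hb) (Real.rpow_nonneg hx0.le _)
  · -- `x < 1`: the low-frequency bound, `min = x^{a'}`
    have hmin : min (x ^ a') (x ^ (-γ)) = x ^ a' := by
      refine min_eq_left ?_
      calc x ^ a' ≤ x ^ (0 : ℝ) := Real.rpow_le_rpow_of_exponent_ge hx0 hx1.le ha'0.le
        _ ≤ x ^ (-γ) := Real.rpow_le_rpow_of_exponent_ge hx0 hx1.le (by linarith)
    rw [hmin]
    refine hlow'.trans (ENNReal.ofReal_le_ofReal ?_)
    exact mul_le_mul_of_nonneg_right (mul_le_mul_of_nonneg_right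
      (mul_le_mul_of_nonneg_right (le_max_left _ _) ha) hb) (Real.rpow_nonneg hx0.le _)

/-- **The Duhamel term of a Kato-class field is in `L^p`** (Minkowski in time, Kato 1984, (2.3);
the `j`-free form of `eLpNorm_blockFn_kochTataruBilinear_le`). [cite: Kato1984, §2 (2.3)] -/
theorem memLp_kochTataruBilinear_of_kato (hp₃ : 3 < p) (hp : p < ∞)
    {u : ℝ → ℝ³ → ℝ³} {T a b : ℝ} (hum : Measurable (uncurry u)) (ha : 0 ≤ a) (hb : 0 ≤ b)
    (hLp : ∀ t ∈ Ioo 0 T, eLpNorm (u t) p volume ≤ ENNReal.ofReal (a * t ^ (-((1 - 3 / p.toReal) / 2))))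
    (hinf : ∀ t ∈ Ioo 0 T, ∀ x, ‖u t x‖ ≤ b * t ^ (-(1 / 2 : ℝ))) {t : ℝ} (ht : t ∈ Ioo 0 T) :
    MemLp (kochTataruBilinear u u t) p volume := by
  have hptop : p ≠ ∞ := hp.ne
  have hpr : (3 : ℝ) < p.toReal := by
    have h := ENNReal.toReal_strict_mono hptop hp₃; simpa using h
  set pr : ℝ := p.toReal with hprdef
  obtain ⟨hγ0, hγ1, -, -, -, -, -, -⟩ := critical_exponents hpr
  set γ : ℝ := 1 - 3 / (2 * pr) with hγ
  have hαγ : -((1 - 3 / pr) / 2) + -(1 / 2 : ℝ) = -γ := by rw [hγ]; ring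
  have ht0 : 0 < t := ht.1
  obtain ⟨CK, hCK, hK⟩ := exists_norm_oseenKernel_le (E := ℝ³)
  set d : ℝ := (Module.finrank ℝ ℝ³ : ℝ) with hd
  set M₁ : ℝ := ∫ w : ℝ³, (1 + ‖w‖ ^ 2) ^ (-((d + 1) / 2)) with hM₁
  have he₁ : d < 2 * ((d + 1) / 2) := by linarith
  have hM₁0 : 0 < M₁ := integral_one_add_norm_sq_rpow_neg_pos he₁
  -- measurability
  have hBm : AEStronglyMeasurable (kochTataruBilinear u u t) volume :=
    ((stronglyMeasurable_uncurry_kochTataruBilinear hum.stronglyMeasurable hum.stronglyMeasurable).measurable.comp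
      (measurable_const.prodMk measurable_id)).aestronglyMeasurable
  refine ⟨hBm, ?_⟩
  -- Minkowski
  set ν : Measure ℝ := (volume : Measure ℝ).restrict (Ioo 0 t) with hν
  have hSm : AEStronglyMeasurable (uncurry fun (x : ℝ³) (τ : ℝ) =>
      ∫ y, oseenKernel (t - τ) (x - y) (u τ y) (u τ y)) ((volume : Measure ℝ³).prod ν) := by
    have h := aestronglyMeasurable_oseenIntegrand_swap hum hum 1 t ν
    simp only [one_mul] at h
    exact h
  have hMink := FunctionSpaces.eLpNorm_integral_le_lintegral_eLpNorm (μ := (volume : Measure ℝ³))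
    (ν := ν) hSm hp1.out hptop
  have hslice : ∀ τ ∈ Ioo 0 t, eLpNorm (fun x => ∫ y, oseenKernel (t - τ) (x - y) (u τ y) (u τ y)) p volume ≤
      ENNReal.ofReal (CK * M₁ * a * b * ((t - τ) ^ (-(1 / 2 : ℝ)) * τ ^ (-γ))) := by
    intro τ hτ
    have hτT : τ ∈ Ioo 0 T := ⟨hτ.1, hτ.2.trans ht.2⟩
    have hσ : 0 < t - τ := sub_pos.2 hτ.2
    have hB0 : 0 ≤ b * τ ^ (-(1 / 2 : ℝ)) := mul_nonneg hb (Real.rpow_nonneg hτ.1.le _)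
    have hN := eLpNorm_norm_mul_norm_le_kato' (hLp τ hτT) hB0 (hinf τ hτT)
    refine (eLpNorm_oseenSlice_le_same hCK.le hK hσ (measurable_slice hum τ).aestronglyMeasurable
      (measurable_slice hum τ).aestronglyMeasurable hp1.out).trans ?_
    refine (mul_le_mul_right hN _).trans (le_of_eq ?_)
    rw [← ENNReal.ofReal_mul (by positivity)]
    congr 1
    rw [show CK * ((t - τ) ^ (-(1 / 2 : ℝ)) * M₁) * (a * τ ^ (-((1 - 3 / pr) / 2)) * (b * τ ^ (-(1 / 2 : ℝ)))) =
      CK * M₁ * a * b * ((t - τ) ^ (-(1 / 2 : ℝ)) * (τ ^ (-((1 - 3 / pr) / 2)) * τ ^ (-(1 / 2 : ℝ)))) by ring,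
      ← Real.rpow_add hτ.1, hαγ]
  calc eLpNorm (kochTataruBilinear u u t) p volume
      = eLpNorm (fun x => ∫ τ in Ioo 0 t, ∫ y, oseenKernel (t - τ) (x - y) (u τ y) (u τ y)) p volume := rfl
    _ ≤ ∫⁻ τ in Ioo 0 t, eLpNorm (fun x => ∫ y, oseenKernel (t - τ) (x - y) (u τ y) (u τ y)) p volume := hMink
    _ ≤ ∫⁻ τ in Ioo 0 t, ENNReal.ofReal (CK * M₁ * a * b * ((t - τ) ^ (-(1 / 2 : ℝ)) * τ ^ (-γ))) :=
        setLIntegral_mono' measurableSet_Ioo hslice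
    _ = ENNReal.ofReal (CK * M₁ * a * b * (t ^ (1 - 1 / 2 - γ) *
          ∫ r in (0 : ℝ)..1, (1 - r) ^ (-(1 / 2 : ℝ)) * r ^ (-γ))) :=
        lintegral_Ioo_ofReal_sub_rpow_mul_rpow (by norm_num) (by norm_num) hγ0.le hγ1 (by positivity) ht0
    _ < ∞ := ENNReal.ofReal_lt_top

/-- The `q = 1` homogeneous Besov norm is the plain sum of the weights. [folklore] -/
theorem eHomBesovNorm_one_eq_tsum {E F : Type*} [NormedAddCommGroup E] [InnerProductSpace ℝ E]
    [FiniteDimensional ℝ E] [MeasurableSpace E] [BorelSpace E] [NormedAddCommGroup F] [NormedSpace ℂ F]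
    [CompleteSpace F] (s : ℝ) (p : ℝ≥0∞) [Fact (1 ≤ p)] (u : 𝓢'(E, F)) :
    FunctionSpaces.eHomBesovNorm s p 1 u = ∑' j : ℤ, FunctionSpaces.lpBlockWeight s p u j := by
  rw [FunctionSpaces.eHomBesovNorm, eLpNorm_one_eq_lintegral_enorm, lintegral_count]
  simp only [enorm_eq_self]

/-- **The `Ḃ^{-1+3/p}_{p,1}` bound of the Duhamel term of a Kato-class field** (parts (i)–(ii) of the
Duhamel hypothesis of `exists_isBesovMildSolutionOn_of_duhamel`; GKP 2016, App. B; BCD, proof of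
Thm. 5.40): for `3 < p < ∞` there are `C > 0` and `K ≥ 0` such that for every jointly measurable `u`
with Kato bounds `(a, b)` on `(0,T)` and every `t ∈ (0,T)`, the Duhamel term `B(u,u)(t)` is an `L^p`
function, and every tempered distribution `W` it defines satisfies `‖W‖_{Ḃ^{-1+3/p}_{p,1}} ≤ C a b`,
with the block profile `2^{j(-1+3/p)}‖Δ̇_j W‖_{L^p} ≤ K a b min((4^jt)^{3/(4p)}, (4^jt)^{-(1-3/(2p))})`.
[cite: GKP2016, App. B] -/
theorem exists_besov_bound_kochTataruBilinear (hp₃ : 3 < p) (hp : p < ∞) :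
    ∃ (C K : ℝ), 0 < C ∧ 0 ≤ K ∧ ∀ ⦃u : ℝ → ℝ³ → ℝ³⦄ ⦃T a b : ℝ⦄, Measurable (uncurry u) →
      0 ≤ a → 0 ≤ b →
      (∀ t ∈ Ioo 0 T, eLpNorm (u t) p volume ≤ ENNReal.ofReal (a * t ^ (-((1 - 3 / p.toReal) / 2)))) →
      (∀ t ∈ Ioo 0 T, ∀ x, ‖u t x‖ ≤ b * t ^ (-(1 / 2 : ℝ))) → ∀ ⦃t : ℝ⦄, t ∈ Ioo 0 T →
      MemLp (kochTataruBilinear u u t) p volume ∧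
      ∀ W : 𝓢'(ℝ³, EuclideanSpace ℂ (Fin 3)), IsDistributionOf (kochTataruBilinear u u t) W →
        (∀ j : ℤ, FunctionSpaces.lpBlockWeight (-1 + 3 / p.toReal) p W j ≤
          ENNReal.ofReal (K * a * b * min (((4 : ℝ) ^ j * t) ^ (3 / (4 * p.toReal)))
            (((4 : ℝ) ^ j * t) ^ (-(1 - 3 / (2 * p.toReal)))))) ∧
        FunctionSpaces.eHomBesovNorm (-1 + 3 / p.toReal) p 1 W ≤ ENNReal.ofReal (C * a * b) := by
  obtain ⟨K, hK0, hK⟩ := exists_lpBlockWeight_kochTataruBilinear_profile (p := p) hp₃ hp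
  have hpr : (3 : ℝ) < p.toReal := by
    have h := ENNReal.toReal_strict_mono hp.ne hp₃; simpa using h
  obtain ⟨hγ0, -, ha'0, -, -, -, -, -⟩ := critical_exponents hpr
  obtain ⟨Kd, hKdtop, hKd⟩ := exists_tsum_dyadic_profile_le (a := 3 / (4 * p.toReal))
    (b := 1 - 3 / (2 * p.toReal)) (M := 1) ha'0 hγ0 zero_le_one
    (h := fun x => min (x ^ (3 / (4 * p.toReal))) (x ^ (-(1 - 3 / (2 * p.toReal)))))
    (fun x _ => min_le_left _ _) (fun x _ => (min_le_right _ _).trans (le_of_eq (one_mul _).symm))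
  refine ⟨K * Kd.toReal + 1, K, by positivity, hK0, ?_⟩
  intro u T a b hum ha hb hLp hinf t ht
  have hBp := memLp_kochTataruBilinear_of_kato hp₃ hp hum ha hb hLp hinf ht
  refine ⟨hBp, fun W hW => ?_⟩
  have hweights : ∀ j : ℤ, FunctionSpaces.lpBlockWeight (-1 + 3 / p.toReal) p W j ≤
      ENNReal.ofReal (K * a * b * min (((4 : ℝ) ^ j * t) ^ (3 / (4 * p.toReal)))
        (((4 : ℝ) ^ j * t) ^ (-(1 - 3 / (2 * p.toReal))))) := by
    intro j
    simp only [FunctionSpaces.lpBlockWeight]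
    rw [hW.eLpNormDistrib_lpBlock_eq hBp j (FunctionSpaces.memLp_blockFn j hBp hp1.out)]
    exact hK hum ha hb hLp hinf t ht j
  refine ⟨hweights, ?_⟩
  rw [eHomBesovNorm_one_eq_tsum]
  have hab : 0 ≤ K * a * b := by positivity
  calc ∑' j : ℤ, FunctionSpaces.lpBlockWeight (-1 + 3 / p.toReal) p W j
      ≤ ∑' j : ℤ, ENNReal.ofReal (K * a * b) * ENNReal.ofReal (min (((4 : ℝ) ^ j * t) ^ (3 / (4 * p.toReal)))
          (((4 : ℝ) ^ j * t) ^ (-(1 - 3 / (2 * p.toReal))))) := by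
        refine ENNReal.tsum_le_tsum fun j => (hweights j).trans (le_of_eq ?_)
        rw [← ENNReal.ofReal_mul hab]
    _ = ENNReal.ofReal (K * a * b) * ∑' j : ℤ, ENNReal.ofReal (min (((4 : ℝ) ^ j * t) ^ (3 / (4 * p.toReal)))
          (((4 : ℝ) ^ j * t) ^ (-(1 - 3 / (2 * p.toReal))))) := ENNReal.tsum_mul_left
    _ ≤ ENNReal.ofReal (K * a * b) * Kd := mul_le_mul_right (hKd t ht.1) _
    _ = ENNReal.ofReal (K * a * b * Kd.toReal) := by
        rw [ENNReal.ofReal_mul hab, ENNReal.ofReal_toReal hKdtop]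
    _ ≤ ENNReal.ofReal ((K * Kd.toReal + 1) * a * b) := by
        refine ENNReal.ofReal_le_ofReal ?_
        nlinarith [mul_nonneg ha hb, ENNReal.toReal_nonneg (a := Kd)]

end KatoProfile



/-! ## Continuity in time of the Duhamel term in `Ḃ^{-1+3/p}_{p,1}` -/

section ShortPiece

/-- Local notation for physical space `ℝ³ = EuclideanSpace ℝ (Fin 3)`. -/
local notation "ℝ³" => EuclideanSpace ℝ (Fin 3)

variable {p : ℝ≥0∞} [hp1 : Fact (1 ≤ p)]

/-- **Block profile of the short-time Duhamel piece** (the restart pieces of GKP 2016, App. B /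
BCD, proof of Thm. 5.40, continuity in time): for `3 < p < ∞` there is `K ≥ 0` such that for
every jointly measurable `u` with `|u| ≤ M` and `‖|u(s)||u(s)|‖_{L^p} ≤ N` on `(t₀, t)`,
`2^{j(-1+3/p)}‖Δ̇_j ∫_{t₀}^t e^{(t-s)Δ}ℙ∇·(u⊗u)(s) ds‖_{L^p}
  ≤ K N (t-t₀)^{γ} min((4^j(t-t₀))^{3/(4p)}, (4^j(t-t₀))^{-γ})`, `γ = 1 - 3/(2p)` — so the
`Ḃ^{-1+3/p}_{p,1}` norm of the piece is `O((t-t₀)^γ)`. [cite: GKP2016, App. B] -/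
theorem exists_lpBlockWeight_oseenDuhamel_one_profile (hp₃ : 3 < p) (hp : p < ∞) :
    ∃ K : ℝ, 0 ≤ K ∧ ∀ ⦃u : ℝ → ℝ³ → ℝ³⦄ ⦃t₀ t N M : ℝ⦄, Measurable (uncurry u) → t₀ < t → 0 ≤ N →
      (∀ s ∈ Ioo t₀ t, ∀ y, ‖u s y‖ ≤ M) →
      (∀ s ∈ Ioo t₀ t, eLpNorm (fun y => ‖u s y‖ * ‖u s y‖) p volume ≤ ENNReal.ofReal N) →
      ∀ j : ℤ, (2 : ℝ≥0∞) ^ ((j : ℝ) * (-1 + 3 / p.toReal)) *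
          eLpNorm (blockFn j (oseenDuhamel 1 t₀ u u t)) p volume ≤
        ENNReal.ofReal (K * N * (t - t₀) ^ (1 - 3 / (2 * p.toReal)) *
          min (((4 : ℝ) ^ j * (t - t₀)) ^ (3 / (4 * p.toReal)))
            (((4 : ℝ) ^ j * (t - t₀)) ^ (-(1 - 3 / (2 * p.toReal))))) := by
  -- ### exponents
  have hptop : p ≠ ∞ := hp.ne
  have hpr : (3 : ℝ) < p.toReal := by
    have h := ENNReal.toReal_strict_mono hptop hp₃; simpa using h
  set pr : ℝ := p.toReal with hprdef
  obtain ⟨hγ0, hγ1, ha'0, hLexp, hsγ, -, hs1, -⟩ := critical_exponents hpr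
  set γ : ℝ := 1 - 3 / (2 * pr) with hγ
  set s : ℝ := -1 + 3 / pr with hsdef
  set a' : ℝ := 3 / (4 * pr) with ha'
  -- ### the constants
  obtain ⟨CL, hCL0, hCL⟩ := exists_lintegral_majorant_le_low (E := ℝ³) hγ0.le hγ1
  obtain ⟨CH, c, hCH0, hc, hCH⟩ := exists_lintegral_majorant_le_high (ι := Fin 3)
  set K₁ : ℝ := CL * (2 / (γ + 1)) with hK₁
  set K₂ : ℝ := CH * (Real.sqrt Real.pi * c ^ (-(1 / 2 : ℝ))) with hK₂
  have hK₁0 : 0 ≤ K₁ := by rw [hK₁]; exact mul_nonneg hCL0 (div_nonneg zero_le_two (by linarith))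
  have hK₂0 : 0 ≤ K₂ := by have := Real.rpow_nonneg hc.le (-(1 / 2 : ℝ)); positivity
  refine ⟨max K₁ K₂, le_max_of_le_left hK₁0, ?_⟩
  intro u t₀ t N M hum htt hN0 hM hN j
  have hh0 : 0 < t - t₀ := sub_pos.2 htt
  set h : ℝ := t - t₀ with hhdef
  set x : ℝ := (4 : ℝ) ^ j * h with hx
  have hx0 : 0 < x := by positivity
  have h4 : ((4 : ℝ) ^ j) = (2 : ℝ) ^ (2 * j) := by rw [zpow_mul]; norm_num
  have h2j : ∀ e : ℝ, (2 : ℝ) ^ ((j : ℝ) * e) = ((4 : ℝ) ^ j) ^ (e / 2) := by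
    intro e
    rw [h4, ← Real.rpow_intCast, ← Real.rpow_mul zero_le_two]
    push_cast; ring_nf
  -- ### Minkowski with constant weights
  have hNi : IntegrableOn (fun s => (t - s) ^ (-(1 / 2 : ℝ)) * N) (Ioo t₀ t) := by
    have h1 : IntervalIntegrable (fun s => (t - s) ^ (-(1 / 2 : ℝ))) volume t₀ t := by
      have h := (intervalIntegral.intervalIntegrable_rpow' (a := 0) (b := t - t₀)
        (show (-1 : ℝ) < -(1 / 2) by norm_num)).comp_sub_left t
      simp only [sub_zero, sub_sub_cancel] at h
      exact h.symm
    rw [intervalIntegrable_iff_integrableOn_Ioo_of_le htt.le] at h1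
    exact h1.mul_const N
  have hMink := eLpNorm_blockFn_oseenDuhamel_one_le j hum hum (t₀ := t₀) (t := t)
    (Mu := fun _ => M) (Mv := fun _ => M) (N := fun _ => N) hM hM hp1.out hptop hN (fun _ _ => hN0) hNi
  -- ### the two regimes
  have hlow : eLpNorm (blockFn j (oseenDuhamel 1 t₀ u u t)) p volume ≤
      ENNReal.ofReal (CL * N * (2 / (γ + 1)) * (2 : ℝ) ^ ((j : ℝ) * γ) * (t - t₀) ^ ((γ + 1) / 2)) := by
    refine hMink.trans ?_
    calc ∫⁻ τ in Ioo t₀ t, (∫⁻ y, ‖∑ k, ∑ l, ‖blockFn j (fun w => oseenKernel (t - τ) w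
            (stdOrthonormalBasis ℝ ℝ³ k) (stdOrthonormalBasis ℝ ℝ³ l)) y‖‖ₑ) * ENNReal.ofReal N
        ≤ ∫⁻ τ in Ioo t₀ t, ENNReal.ofReal (CL * (2 : ℝ) ^ ((j : ℝ) * γ) * (t - τ) ^ ((γ - 1) / 2)) *
            ENNReal.ofReal N :=
          setLIntegral_mono' measurableSet_Ioo fun τ hτ =>
            mul_le_mul_left (hCL j (sub_pos.2 hτ.2)) _
      _ = _ := lintegral_Ioo_low_const hγ0.le hCL0 hN0 htt j
  have hhigh : eLpNorm (blockFn j (oseenDuhamel 1 t₀ u u t)) p volume ≤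
      ENNReal.ofReal (CH * N * (Real.sqrt Real.pi * (c * 2 ^ (2 * j)) ^ (-(1 / 2 : ℝ)))) := by
    refine hMink.trans ?_
    calc ∫⁻ τ in Ioo t₀ t, (∫⁻ y, ‖∑ k, ∑ l, ‖blockFn j (fun w => oseenKernel (t - τ) w
            (stdOrthonormalBasis ℝ ℝ³ k) (stdOrthonormalBasis ℝ ℝ³ l)) y‖‖ₑ) * ENNReal.ofReal N
        ≤ ∫⁻ τ in Ioo t₀ t, ENNReal.ofReal (CH * Real.exp (-(c * (t - τ) * 2 ^ (2 * j))) *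
            (t - τ) ^ (-(1 / 2 : ℝ))) * ENNReal.ofReal N :=
          setLIntegral_mono' measurableSet_Ioo fun τ hτ =>
            mul_le_mul_left (hCH j (sub_pos.2 hτ.2)) _
      _ ≤ _ := lintegral_Ioo_high_const_le_gamma hc hCH0 hN0 j
  -- ### the profile
  have hw : (2 : ℝ≥0∞) ^ ((j : ℝ) * s) = ENNReal.ofReal ((2 : ℝ) ^ ((j : ℝ) * s)) := by
    rw [← ENNReal.ofReal_ofNat 2, ENNReal.ofReal_rpow_of_pos two_pos]
  have hlow' : (2 : ℝ≥0∞) ^ ((j : ℝ) * s) * eLpNorm (blockFn j (oseenDuhamel 1 t₀ u u t)) p volume ≤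
      ENNReal.ofReal (K₁ * N * h ^ γ * x ^ a') := by
    rw [hw]
    refine (mul_le_mul_right hlow _).trans (le_of_eq ?_)
    rw [← ENNReal.ofReal_mul (Real.rpow_nonneg zero_le_two _)]
    congr 1
    have e1 : (2 : ℝ) ^ ((j : ℝ) * s) * (2 : ℝ) ^ ((j : ℝ) * γ) = ((4 : ℝ) ^ j) ^ a' := by
      rw [← Real.rpow_add two_pos, show (j : ℝ) * s + (j : ℝ) * γ = (j : ℝ) * (s + γ) by ring, h2j,
        show (s + γ) / 2 = a' from hsγ]
    have e2 : h ^ ((γ + 1) / 2) = h ^ a' * h ^ γ := by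
      rw [← Real.rpow_add hh0]; congr 1; linarith [hLexp]
    have e3 : x ^ a' = ((4 : ℝ) ^ j) ^ a' * h ^ a' := by
      rw [hx, Real.mul_rpow (zpow_nonneg (by norm_num) _) hh0.le]
    calc (2 : ℝ) ^ ((j : ℝ) * s) * (CL * N * (2 / (γ + 1)) * (2 : ℝ) ^ ((j : ℝ) * γ) * (t - t₀) ^ ((γ + 1) / 2))
        = CL * (2 / (γ + 1)) * N * ((2 : ℝ) ^ ((j : ℝ) * s) * (2 : ℝ) ^ ((j : ℝ) * γ)) * h ^ ((γ + 1) / 2) := by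
          rw [hhdef]; ring
      _ = K₁ * N * h ^ γ * x ^ a' := by rw [e1, e2, e3, hK₁]; ring
  have hhigh' : (2 : ℝ≥0∞) ^ ((j : ℝ) * s) * eLpNorm (blockFn j (oseenDuhamel 1 t₀ u u t)) p volume ≤
      ENNReal.ofReal (K₂ * N * h ^ γ * x ^ (-γ)) := by
    rw [hw]
    refine (mul_le_mul_right hhigh _).trans (le_of_eq ?_)
    rw [← ENNReal.ofReal_mul (Real.rpow_nonneg zero_le_two _)]
    congr 1
    have hpow : ((4 : ℝ) ^ j) ^ (s / 2) * ((4 : ℝ) ^ j) ^ (-(1 / 2 : ℝ)) = ((4 : ℝ) ^ j) ^ (-γ) := by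
      rw [← Real.rpow_add (zpow_pos (by norm_num) _), ← hs1]; congr 1; ring
    have hxγ : ((4 : ℝ) ^ j) ^ (-γ) = h ^ γ * x ^ (-γ) := by
      rw [hx, Real.mul_rpow (zpow_nonneg (by norm_num) _) hh0.le, mul_left_comm, ← Real.rpow_add hh0,
        add_neg_cancel, Real.rpow_zero, mul_one]
    calc (2 : ℝ) ^ ((j : ℝ) * s) * (CH * N * (Real.sqrt Real.pi * (c * 2 ^ (2 * j)) ^ (-(1 / 2 : ℝ))))
        = CH * (Real.sqrt Real.pi * c ^ (-(1 / 2 : ℝ))) * N *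
            (((4 : ℝ) ^ j) ^ (s / 2) * ((4 : ℝ) ^ j) ^ (-(1 / 2 : ℝ))) := by
          rw [Real.mul_rpow hc.le (zpow_nonneg (by norm_num) _), ← h4, h2j]; ring
      _ = K₂ * N * h ^ γ * x ^ (-γ) := by rw [hpow, hxγ, hK₂]; ring
  -- ### conclusion
  rcases le_or_gt 1 x with hx1 | hx1
  · have hmin : min (x ^ a') (x ^ (-γ)) = x ^ (-γ) := by
      refine min_eq_right ?_
      calc x ^ (-γ) ≤ x ^ (0 : ℝ) := Real.rpow_le_rpow_of_exponent_le hx1 (by linarith)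
        _ ≤ x ^ a' := Real.rpow_le_rpow_of_exponent_le hx1 ha'0.le
    rw [hmin]
    refine hhigh'.trans (ENNReal.ofReal_le_ofReal ?_)
    exact mul_le_mul_of_nonneg_right (mul_le_mul_of_nonneg_right
      (mul_le_mul_of_nonneg_right (le_max_right _ _) hN0) (Real.rpow_nonneg hh0.le _))
      (Real.rpow_nonneg hx0.le _)
  · have hmin : min (x ^ a') (x ^ (-γ)) = x ^ a' := by
      refine min_eq_left ?_
      calc x ^ a' ≤ x ^ (0 : ℝ) := Real.rpow_le_rpow_of_exponent_ge hx0 hx1.le ha'0.le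
        _ ≤ x ^ (-γ) := Real.rpow_le_rpow_of_exponent_ge hx0 hx1.le (by linarith)
    rw [hmin]
    refine hlow'.trans (ENNReal.ofReal_le_ofReal ?_)
    exact mul_le_mul_of_nonneg_right (mul_le_mul_of_nonneg_right
      (mul_le_mul_of_nonneg_right (le_max_left _ _) hN0) (Real.rpow_nonneg hh0.le _))
      (Real.rpow_nonneg hx0.le _)

omit hp1 in
/-- **The restart identity for the Duhamel term of a (global) Kato-class field**
(Lemarié-Rieusset 2016, Thm. 6.1: the Oseen tensor is a semigroup in time; KNSS 2009, §4:
`u = U + B(u,u)` as an ODE in `t`): for `0 < t₀ < t` and every `x`,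
`B(u,u)(t)(x) = e^{(t-t₀)Δ}[B(u,u)(t₀)](x) + ∫_{t₀}^t e^{(t-s)Δ}ℙ∇·(u⊗u)(s) ds (x)`. The field lies
in Koch–Tataru's path space (`KatoLp.eKochTataruNorm_lt_top_of_kato_bounds`), so all integrals
converge absolutely (`heatExtension_kochTataruBilinear_eq`). [cite: LemarieRieusset2016, Thm. 6.1] -/
theorem kochTataruBilinear_eq_heatExtension_add_oseenDuhamel (hp₃ : 3 < p) (hp : p < ∞)
    {u : ℝ → ℝ³ → ℝ³} {a b : ℝ} (hum : Measurable (uncurry u))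
    (hLp : ∀ t, 0 < t → eLpNorm (u t) p volume ≤ ENNReal.ofReal (a * t ^ (-((1 - 3 / p.toReal) / 2))))
    (hinf : ∀ t, 0 < t → ∀ x, ‖u t x‖ ≤ b * t ^ (-(1 / 2 : ℝ))) {t₀ t : ℝ} (ht₀ : 0 < t₀)
    (ht₀t : t₀ < t) (x : ℝ³) :
    kochTataruBilinear u u t x =
      UnboundedOperators.heatExtension (kochTataruBilinear u u t₀) (t - t₀) x +
        oseenDuhamel 1 t₀ u u t x := by
  have hE : Module.finrank ℝ ℝ³ = 3 := by simp
  have hX : eKochTataruNorm u < ∞ := KatoLp.eKochTataruNorm_lt_top_of_kato_bounds hE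
    (fun τ _ => (measurable_slice hum τ).aestronglyMeasurable) hp₃ hp hinf hLp
  have hu' : AEStronglyMeasurable (uncurry u) ((volume : Measure (ℝ × ℝ³)).restrict (Ioi 0 ×ˢ univ)) :=
    hum.aestronglyMeasurable
  have ht : 0 < t := ht₀.trans ht₀t
  have hτ : 0 < t - t₀ := sub_pos.2 ht₀t
  obtain ⟨F, hF⟩ : ∃ F : ℝ × ℝ³ → ℝ³,
      F = fun q => oseenKernel (t - q.1) (x - q.2) (u q.1 q.2) (u q.1 q.2) := ⟨_, rfl⟩
  have hFt : Integrable F ((volume : Measure (ℝ × ℝ³)).restrict (Ioo 0 t ×ˢ univ)) := by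
    rw [hF]; exact integrable_oseenKernel_duhamel hu' hu' hX hX ht x
  have hFi : Integrable F (((volume : Measure ℝ).restrict (Ioo 0 t)).prod (volume : Measure ℝ³)) := by
    rw [← volume_restrict_prod_univ_eq_prod]; exact hFt
  have hFi₀ : Integrable F (((volume : Measure ℝ).restrict (Ioo 0 t₀)).prod (volume : Measure ℝ³)) := by
    rw [← volume_restrict_prod_univ_eq_prod]
    exact hFt.mono_measure (Measure.restrict_mono (prod_mono (Ioo_subset_Ioo_right ht₀t.le) subset_rfl) le_rfl)
  have hSi : IntegrableOn (fun s => ∫ y, F (s, y)) (Ioo 0 t) volume := hFi.integral_prod_left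
  -- `B(u,u)(t)(x) = ∫_{(0,t₀)} + ∫_{(t₀,t)}`
  have hB : kochTataruBilinear u u t x = ∫ s in Ioo 0 t, ∫ y, F (s, y) := by rw [hF]; rfl
  have hD : oseenDuhamel 1 t₀ u u t x = ∫ s in Ioo t₀ t, ∫ y, F (s, y) := by
    rw [oseenDuhamel_apply, hF]; simp only [one_mul]
  have hH : UnboundedOperators.heatExtension (kochTataruBilinear u u t₀) (t - t₀) x =
      ∫ s in Ioo 0 t₀, ∫ y, F (s, y) := by
    rw [heatExtension_kochTataruBilinear_eq hu' hu' hX hX ht₀ hτ x]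
    have hker : ∀ q : ℝ × ℝ³,
        oseenKernel (t₀ - q.1 + (t - t₀)) (x - q.2) (u q.1 q.2) (u q.1 q.2) = F q := by
      intro q; rw [hF, show t₀ - q.1 + (t - t₀) = t - q.1 by ring]
    simp_rw [hker]
    rw [volume_restrict_prod_univ_eq_prod, integral_prod _ hFi₀]
  rw [hB, setIntegral_Ioo_eq_add_setIntegral_Ioo ht₀ ht₀t hSi, hH, hD]

end ShortPiece

/-! ## The Duhamel hypothesis of `exists_isBesovMildSolutionOn_of_duhamel` -/

section Continuity

/-- Local notation for physical space `ℝ³ = EuclideanSpace ℝ (Fin 3)`. -/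
local notation "ℝ³" => EuclideanSpace ℝ (Fin 3)

/-- Local notation for the complexified target `ℂ³ = EuclideanSpace ℂ (Fin 3)`. -/
local notation "ℂ³" => EuclideanSpace ℂ (Fin 3)

variable {p : ℝ≥0∞} [hp1 : Fact (1 ≤ p)]

omit hp1 in
/-- `min(a₁, b₁) ≤ c·min(A, B)` from `a₁ ≤ A`, `b₁ ≤ cB`, `c ≥ 1`, `A ≥ 0`. [folklore] -/
private theorem min_le_mul_min {a₁ b₁ A B c : ℝ} (hc : 1 ≤ c) (hA : 0 ≤ A) (ha : a₁ ≤ A)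
    (hb : b₁ ≤ c * B) : min a₁ b₁ ≤ c * min A B := by
  rcases le_total A B with h | h
  · rw [min_eq_left h]; exact (min_le_left _ _).trans (ha.trans (le_mul_of_one_le_left hA hc))
  · rw [min_eq_right h]; exact (min_le_right _ _).trans hb

omit hp1 in
/-- `∑_j ofReal (c · f j) = ofReal c · ∑_j ofReal (f j)` for `c ≥ 0`. [folklore] -/
private theorem tsum_ofReal_const_mul {c : ℝ} (hc : 0 ≤ c) (f : ℤ → ℝ) :
    ∑' j : ℤ, ENNReal.ofReal (c * f j) = ENNReal.ofReal c * ∑' j : ℤ, ENNReal.ofReal (f j) := by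
  rw [← ENNReal.tsum_mul_left]
  exact tsum_congr fun j => ENNReal.ofReal_mul hc

/-- **Besov regularity and time continuity of the Duhamel term of a global Kato-class field**
(GKP 2016, App. B; BCD, proof of Thm. 5.40; the Duhamel hypothesis of
`exists_isBesovMildSolutionOn_of_duhamel` for fields with Kato bounds on all of `(0, ∞)`): for
`3 < p < ∞` there is `C > 0` such that for every jointly measurable `u` with
`‖u(t)‖_{L^p} ≤ a t^{-(1-3/p)/2}` and `|u(t)(x)| ≤ b t^{-1/2}` for `t > 0`, the tempered
distributions `V(t)` of the `L^p` functions `B(u,u)(t)` (`t > 0`; `V(t) = 0` for `t ≤ 0`) satisfy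
`‖V(t)‖_{Ḃ^{-1+3/p}_{p,1}} ≤ C a b` and `t ↦ V(t)` is continuous on `(0, ∞)` in the
`Ḃ^{-1+3/p}_{p,1}` norm: at `t₀`, `V(t) - V(t₀) = (e^{(t-t₀)Δ} - 1)V(t₀) + V_{t₀}(t)` for `t > t₀`
(restart identity `kochTataruBilinear_eq_heatExtension_add_oseenDuhamel`), the first term tending
to `0` by the strong continuity of the heat semigroup on a single element
(`MemHomBesov.tendsto_eHomBesovNorm_heatSemigroup_sub_self`), uniformly over the profile-dominated
family `{V(t) : t ∈ [t₀/2, t₀]}` for `t < t₀`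
(`eventually_eHomBesovNorm_heatSemigroup_sub_le_of_profile`), and the short piece being
`O(|t-t₀|^{1-3/(2p)})` (`exists_lpBlockWeight_oseenDuhamel_one_profile`). [cite: GKP2016, App. B] -/
theorem exists_besov_duhamel_of_global_kato (hp₃ : 3 < p) (hp : p < ∞) :
    ∃ C : ℝ, 0 < C ∧ ∀ ⦃u : ℝ → ℝ³ → ℝ³⦄ ⦃a b : ℝ⦄, Measurable (uncurry u) → 0 ≤ a → 0 ≤ b →
      (∀ t, 0 < t → eLpNorm (u t) p volume ≤ ENNReal.ofReal (a * t ^ (-((1 - 3 / p.toReal) / 2)))) →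
      (∀ t, 0 < t → ∀ x, ‖u t x‖ ≤ b * t ^ (-(1 / 2 : ℝ))) →
        ∃ V : ℝ → 𝓢'(ℝ³, ℂ³),
          (∀ t, 0 < t → IsDistributionOf (kochTataruBilinear u u t) (V t)) ∧
          (∀ t, 0 < t → FunctionSpaces.eHomBesovNorm (-1 + 3 / p.toReal) p 1 (V t) ≤
              ENNReal.ofReal (C * a * b)) ∧
          ∀ t₀, 0 < t₀ → Tendsto
            (fun t => FunctionSpaces.eHomBesovNorm (-1 + 3 / p.toReal) p 1 (V t - V t₀)) (𝓝 t₀) (𝓝 0) := by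
  classical
  -- ### exponents and constants
  have hptop : p ≠ ∞ := hp.ne
  have hpr : (3 : ℝ) < p.toReal := by
    have h := ENNReal.toReal_strict_mono hptop hp₃; simpa using h
  set pr : ℝ := p.toReal with hprdef
  obtain ⟨hγ0, hγ1, ha'0, -, -, -, -, -⟩ := critical_exponents hpr
  set γ : ℝ := 1 - 3 / (2 * pr) with hγ
  set s : ℝ := -1 + 3 / pr with hsdef
  set a' : ℝ := 3 / (4 * pr) with ha'
  have hαγ : -((1 - 3 / pr) / 2) + -(1 / 2 : ℝ) = -γ := by rw [hγ]; ring
  obtain ⟨C, K, hC, hK0, hCK⟩ := exists_besov_bound_kochTataruBilinear (p := p) hp₃ hp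
  obtain ⟨K', hK'0, hK'⟩ := exists_lpBlockWeight_oseenDuhamel_one_profile (p := p) hp₃ hp
  obtain ⟨Kd, hKdtop, hKd⟩ := exists_tsum_dyadic_profile_le (a := a') (b := γ) (M := 1) ha'0 hγ0
    zero_le_one (h := fun x => min (x ^ a') (x ^ (-γ)))
    (fun x _ => min_le_left _ _) (fun x _ => (min_le_right _ _).trans (le_of_eq (one_mul _).symm))
  refine ⟨C, hC, ?_⟩
  intro u a b hum ha hb hLp hinf
  have hab : 0 ≤ a * b := mul_nonneg ha hb
  -- ### the `L^p` functions `B(u,u)(t)` and their distributions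
  have hLpT : ∀ T : ℝ, ∀ t ∈ Ioo 0 T,
      eLpNorm (u t) p volume ≤ ENNReal.ofReal (a * t ^ (-((1 - 3 / pr) / 2))) := fun T t ht => hLp t ht.1
  have hinfT : ∀ T : ℝ, ∀ t ∈ Ioo 0 T, ∀ x, ‖u t x‖ ≤ b * t ^ (-(1 / 2 : ℝ)) :=
    fun T t ht => hinf t ht.1
  have hmem : ∀ t, 0 < t → MemLp (kochTataruBilinear u u t) p volume := fun t ht =>
    (hCK hum ha hb (hLpT (t + 1)) (hinfT (t + 1)) ⟨ht, lt_add_one t⟩).1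
  obtain ⟨V, hV⟩ : ∃ V : ℝ → 𝓢'(ℝ³, ℂ³), V = fun t => if ht : 0 < t then
      Lp.toTemperedDistribution ((memLp_complexify_comp (hmem t ht)).toLp _) else 0 := ⟨_, rfl⟩
  have hVt : ∀ t (ht : 0 < t),
      V t = Lp.toTemperedDistribution ((memLp_complexify_comp (hmem t ht)).toLp _) := by
    intro t ht; rw [hV]; exact dif_pos ht
  have hVd : ∀ t, 0 < t → IsDistributionOf (kochTataruBilinear u u t) (V t) := fun t ht => by
    rw [hVt t ht]; exact isDistributionOf_toTemperedDistribution (hmem t ht)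
  have hVw : ∀ t, 0 < t → ∀ j : ℤ, FunctionSpaces.lpBlockWeight s p (V t) j ≤
      ENNReal.ofReal (K * a * b * min (((4 : ℝ) ^ j * t) ^ a') (((4 : ℝ) ^ j * t) ^ (-γ))) :=
    fun t ht => ((hCK hum ha hb (hLpT (t + 1)) (hinfT (t + 1)) ⟨ht, lt_add_one t⟩).2 (V t) (hVd t ht)).1
  have hVn : ∀ t, 0 < t → FunctionSpaces.eHomBesovNorm s p 1 (V t) ≤ ENNReal.ofReal (C * a * b) :=
    fun t ht => ((hCK hum ha hb (hLpT (t + 1)) (hinfT (t + 1)) ⟨ht, lt_add_one t⟩).2 (V t) (hVd t ht)).2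
  refine ⟨V, hVd, hVn, fun t₀ ht₀ => ?_⟩
  -- ### the restart estimate: for `0 < t₁ < t₂`,
  -- `‖V t₂ - V t₁‖ ≤ ‖e^{(t₂-t₁)Δ}V t₁ - V t₁‖ + K' (a b t₁^{-γ}) (t₂-t₁)^γ · Kd`
  have hrestart : ∀ ⦃t₁ t₂ : ℝ⦄, 0 < t₁ → t₁ < t₂ →
      FunctionSpaces.eHomBesovNorm s p 1 (V t₂ - V t₁) ≤
        FunctionSpaces.eHomBesovNorm s p 1 (TemperedDistribution.heatSemigroup (t₂ - t₁) (V t₁) - V t₁) +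
          ENNReal.ofReal (K' * (a * b * t₁ ^ (-γ)) * (t₂ - t₁) ^ γ) * Kd := by
    intro t₁ t₂ ht₁ ht₁₂
    have ht₂ : 0 < t₂ := ht₁.trans ht₁₂
    have hτ : 0 < t₂ - t₁ := sub_pos.2 ht₁₂
    -- the heat piece
    have hfin : FunctionSpaces.eLpNormDistrib p
        (TemperedDistribution.heatSemigroup (t₂ - t₁) (V t₁)) < ∞ := by
      rw [hVt t₁ ht₁]
      exact (eLpNormDistrib_heatSemigroup_coe_le _ hτ.le).trans_lt enorm_lt_top
    have hheat := isDistributionOf_heatExtension_of_eLpNormDistrib_lt_top' (hVd t₁ ht₁) (p := p) hτ hfin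
    -- the short piece as a difference
    have hDfun : oseenDuhamel 1 t₁ u u t₂ = kochTataruBilinear u u t₂ -
        UnboundedOperators.heatExtension (kochTataruBilinear u u t₁) (t₂ - t₁) := by
      funext x
      rw [Pi.sub_apply, kochTataruBilinear_eq_heatExtension_add_oseenDuhamel hp₃ hp hum hLp hinf ht₁ ht₁₂ x,
        add_sub_cancel_left]
    have hDd : IsDistributionOf (oseenDuhamel 1 t₁ u u t₂)
        (V t₂ - TemperedDistribution.heatSemigroup (t₂ - t₁) (V t₁)) := by
      rw [hDfun]; exact (hVd t₂ ht₂).sub hheat.1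
    have hDm : MemLp (oseenDuhamel 1 t₁ u u t₂) p volume := by
      rw [hDfun]; exact (hmem t₂ ht₂).sub hheat.2
    -- Kato data on `(t₁, t₂)`
    have hM : ∀ τ ∈ Ioo t₁ t₂, ∀ y, ‖u τ y‖ ≤ b * t₁ ^ (-(1 / 2 : ℝ)) := by
      intro τ hτ' y
      refine (hinf τ (ht₁.trans hτ'.1) y).trans ?_
      exact mul_le_mul_of_nonneg_left (Real.rpow_le_rpow_of_nonpos ht₁ hτ'.1.le (by norm_num)) hb
    have hN : ∀ τ ∈ Ioo t₁ t₂, eLpNorm (fun y => ‖u τ y‖ * ‖u τ y‖) p volume ≤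
        ENNReal.ofReal (a * b * t₁ ^ (-γ)) := by
      intro τ hτ'
      have hτ0 : 0 < τ := ht₁.trans hτ'.1
      have hB0 : 0 ≤ b * τ ^ (-(1 / 2 : ℝ)) := mul_nonneg hb (Real.rpow_nonneg hτ0.le _)
      refine (eLpNorm_norm_mul_norm_le_kato' (hLp τ hτ0) hB0 (hinf τ hτ0)).trans
        (ENNReal.ofReal_le_ofReal ?_)
      rw [show a * τ ^ (-((1 - 3 / pr) / 2)) * (b * τ ^ (-(1 / 2 : ℝ))) =
        a * b * (τ ^ (-((1 - 3 / pr) / 2)) * τ ^ (-(1 / 2 : ℝ))) by ring, ← Real.rpow_add hτ0, hαγ]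
      exact mul_le_mul_of_nonneg_left (Real.rpow_le_rpow_of_nonpos ht₁ hτ'.1.le (by linarith)) hab
    have hN0 : 0 ≤ a * b * t₁ ^ (-γ) := mul_nonneg hab (Real.rpow_nonneg ht₁.le _)
    -- the Besov norm of the short piece
    have hY : FunctionSpaces.eHomBesovNorm s p 1 (V t₂ - TemperedDistribution.heatSemigroup (t₂ - t₁) (V t₁)) ≤
        ENNReal.ofReal (K' * (a * b * t₁ ^ (-γ)) * (t₂ - t₁) ^ γ) * Kd := by
      rw [eHomBesovNorm_one_eq_tsum]
      have hwj : ∀ j : ℤ, FunctionSpaces.lpBlockWeight s p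
          (V t₂ - TemperedDistribution.heatSemigroup (t₂ - t₁) (V t₁)) j ≤
          ENNReal.ofReal (K' * (a * b * t₁ ^ (-γ)) * (t₂ - t₁) ^ γ *
            min (((4 : ℝ) ^ j * (t₂ - t₁)) ^ a') (((4 : ℝ) ^ j * (t₂ - t₁)) ^ (-γ))) := by
        intro j
        simp only [FunctionSpaces.lpBlockWeight]
        rw [hDd.eLpNormDistrib_lpBlock_eq hDm j (FunctionSpaces.memLp_blockFn j hDm hp1.out)]
        exact hK' hum ht₁₂ hN0 hM hN j
      have hc0 : 0 ≤ K' * (a * b * t₁ ^ (-γ)) * (t₂ - t₁) ^ γ :=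
        mul_nonneg (mul_nonneg hK'0 hN0) (Real.rpow_nonneg hτ.le _)
      calc ∑' j : ℤ, FunctionSpaces.lpBlockWeight s p
            (V t₂ - TemperedDistribution.heatSemigroup (t₂ - t₁) (V t₁)) j
          ≤ ∑' j : ℤ, ENNReal.ofReal (K' * (a * b * t₁ ^ (-γ)) * (t₂ - t₁) ^ γ *
              min (((4 : ℝ) ^ j * (t₂ - t₁)) ^ a') (((4 : ℝ) ^ j * (t₂ - t₁)) ^ (-γ))) :=
            ENNReal.tsum_le_tsum hwj
        _ = ENNReal.ofReal (K' * (a * b * t₁ ^ (-γ)) * (t₂ - t₁) ^ γ) *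
              ∑' j : ℤ, ENNReal.ofReal (min (((4 : ℝ) ^ j * (t₂ - t₁)) ^ a')
                (((4 : ℝ) ^ j * (t₂ - t₁)) ^ (-γ))) := tsum_ofReal_const_mul hc0 _
        _ ≤ _ := mul_le_mul_right (hKd (t₂ - t₁) hτ) _
    -- assembling
    have halg : V t₂ - V t₁ = (TemperedDistribution.heatSemigroup (t₂ - t₁) (V t₁) - V t₁) +
        (V t₂ - TemperedDistribution.heatSemigroup (t₂ - t₁) (V t₁)) := (sub_add_sub_cancel' _ _ _).symm
    rw [halg]
    exact (eHomBesovNorm_add_le s p le_rfl _ _).trans (add_le_add le_rfl hY)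
  -- ### the short-piece size tends to zero
  have hG : ∀ N : ℝ, 0 ≤ N → Tendsto (fun h : ℝ => ENNReal.ofReal (K' * N * h ^ γ) * Kd) (𝓝[≥] 0) (𝓝 0) := by
    intro N hN
    have h1 : Tendsto (fun h : ℝ => K' * N * h ^ γ) (𝓝[≥] 0) (𝓝 0) := by
      have hc : Tendsto (fun h : ℝ => h ^ γ) (𝓝[≥] 0) (𝓝 0) := by
        have := (Real.continuousAt_rpow_const 0 γ (Or.inr hγ0.le)).tendsto
        rw [Real.zero_rpow hγ0.ne'] at this
        exact this.mono_left nhdsWithin_le_nhds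
      simpa using hc.const_mul (K' * N)
    have h2 : Tendsto (fun h : ℝ => ENNReal.ofReal (K' * N * h ^ γ)) (𝓝[≥] 0) (𝓝 0) := by
      rw [← ENNReal.ofReal_zero]; exact ENNReal.tendsto_ofReal h1
    have h3 := ENNReal.Tendsto.mul_const h2 (Or.inr hKdtop)
    rwa [zero_mul] at h3
  -- ### right continuity at `t₀`
  have hmapR : Tendsto (fun t : ℝ => t - t₀) (𝓝[≥] t₀) (𝓝[≥] 0) := by
    refine tendsto_nhdsWithin_iff.2 ⟨?_, ?_⟩
    · have h := ((continuous_sub_right t₀).tendsto t₀)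
      rw [sub_self] at h
      exact h.mono_left nhdsWithin_le_nhds
    · exact eventually_mem_nhdsWithin.mono fun t ht => mem_Ici.2 (sub_nonneg.2 ht)
  have hmapL : Tendsto (fun t : ℝ => t₀ - t) (𝓝[≤] t₀) (𝓝[≥] 0) := by
    refine tendsto_nhdsWithin_iff.2 ⟨?_, ?_⟩
    · have h := ((continuous_sub_left t₀).tendsto t₀)
      rw [sub_self] at h
      exact h.mono_left nhdsWithin_le_nhds
    · exact eventually_mem_nhdsWithin.mono fun t ht => mem_Ici.2 (sub_nonneg.2 ht)
  have hMB : FunctionSpaces.MemHomBesov s p 1 (V t₀) :=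
    ⟨(hVn t₀ ht₀).trans_lt ENNReal.ofReal_lt_top,
      tendsto_lowFreqCutoff_of_memLp_of_isDistributionOf hp (hmem t₀ ht₀) (hVd t₀ ht₀)⟩
  have hright : Tendsto (fun t => FunctionSpaces.eHomBesovNorm s p 1 (V t - V t₀)) (𝓝[≥] t₀) (𝓝 0) := by
    rw [ENNReal.tendsto_nhds_zero]
    intro ε hε
    have hε2 : 0 < ε / 2 := ENNReal.half_pos hε.ne'
    have hF₁ := (FunctionSpaces.MemHomBesov.tendsto_eHomBesovNorm_heatSemigroup_sub_self one_ne_zero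
      ENNReal.one_ne_top hMB).comp hmapR
    have e1 := ENNReal.tendsto_nhds_zero.1 hF₁ (ε / 2) hε2
    have e2 := ENNReal.tendsto_nhds_zero.1 ((hG (a * b * t₀ ^ (-γ))
      (mul_nonneg hab (Real.rpow_nonneg ht₀.le _))).comp hmapR) (ε / 2) hε2
    filter_upwards [e1, e2, eventually_mem_nhdsWithin] with t h1 h2 ht
    rcases (mem_Ici.1 ht).eq_or_lt with heq | hlt
    · rw [← heq, sub_self, FunctionSpaces.eHomBesovNorm_zero]; exact bot_le
    · refine (hrestart ht₀ hlt).trans ?_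
      simp only [Function.comp] at h1 h2
      calc _ ≤ ε / 2 + ε / 2 := add_le_add h1 h2
        _ = ε := ENNReal.add_halves ε
  -- ### left continuity at `t₀`: a profile dominating `V t`, `t ∈ [t₀/2, t₀]`
  obtain ⟨bj, hbj⟩ : ∃ bj : ℤ → ℝ≥0∞, bj = fun j => ENNReal.ofReal (K * a * b * (2 : ℝ) ^ γ *
    min (((4 : ℝ) ^ j * t₀) ^ a') (((4 : ℝ) ^ j * t₀) ^ (-γ))) := ⟨_, rfl⟩
  have h2γ : 1 ≤ (2 : ℝ) ^ γ := Real.one_le_rpow one_le_two hγ0.le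
  have hdom : ∀ t, t₀ / 2 ≤ t → t ≤ t₀ → ∀ j, FunctionSpaces.lpBlockWeight s p (V t) j ≤ bj j := by
    intro t ht1 ht2 j
    have ht : 0 < t := (half_pos ht₀).trans_le ht1
    rw [hbj]
    refine (hVw t ht j).trans (ENNReal.ofReal_le_ofReal ?_)
    have h4j : 0 < (4 : ℝ) ^ j := zpow_pos (by norm_num) _
    have hmin : min (((4 : ℝ) ^ j * t) ^ a') (((4 : ℝ) ^ j * t) ^ (-γ)) ≤
        (2 : ℝ) ^ γ * min (((4 : ℝ) ^ j * t₀) ^ a') (((4 : ℝ) ^ j * t₀) ^ (-γ)) := by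
      refine min_le_mul_min h2γ (Real.rpow_nonneg (by positivity) _) ?_ ?_
      · exact Real.rpow_le_rpow (by positivity) (mul_le_mul_of_nonneg_left ht2 h4j.le) ha'0.le
      · calc ((4 : ℝ) ^ j * t) ^ (-γ) ≤ ((4 : ℝ) ^ j * t₀ / 2) ^ (-γ) :=
              Real.rpow_le_rpow_of_nonpos (by positivity) (by rw [mul_div_assoc]; gcongr) (by linarith)
          _ = (2 : ℝ) ^ γ * ((4 : ℝ) ^ j * t₀) ^ (-γ) := by
              rw [Real.div_rpow (by positivity) zero_le_two, Real.rpow_neg zero_le_two, div_inv_eq_mul,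
                mul_comm]
    calc K * a * b * min (((4 : ℝ) ^ j * t) ^ a') (((4 : ℝ) ^ j * t) ^ (-γ))
        ≤ K * a * b * ((2 : ℝ) ^ γ * min (((4 : ℝ) ^ j * t₀) ^ a') (((4 : ℝ) ^ j * t₀) ^ (-γ))) :=
          mul_le_mul_of_nonneg_left hmin (by positivity)
      _ = _ := by ring
  have hbℓ : eLpNorm bj 1 Measure.count < ⊤ := by
    rw [eLpNorm_one_eq_lintegral_enorm, lintegral_count]
    simp only [enorm_eq_self, hbj]
    rw [tsum_ofReal_const_mul (by positivity)]
    exact ENNReal.mul_lt_top ENNReal.ofReal_lt_top ((hKd t₀ ht₀).trans_lt hKdtop.lt_top)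
  have hleft : Tendsto (fun t => FunctionSpaces.eHomBesovNorm s p 1 (V t - V t₀)) (𝓝[≤] t₀) (𝓝 0) := by
    rw [ENNReal.tendsto_nhds_zero]
    intro ε hε
    have hε2 : 0 < ε / 2 := ENNReal.half_pos hε.ne'
    have e1 := hmapL.eventually (FunctionSpaces.eventually_eHomBesovNorm_heatSemigroup_sub_le_of_profile
      (E := ℝ³) (F := ℂ³) (s := s) (p := p) (q := 1) one_ne_zero ENNReal.one_ne_top hbℓ hε2)
    have e2 := ENNReal.tendsto_nhds_zero.1 ((hG (a * b * (t₀ / 2) ^ (-γ))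
      (mul_nonneg hab (Real.rpow_nonneg (half_pos ht₀).le _))).comp hmapL) (ε / 2) hε2
    have e3 : ∀ᶠ t in 𝓝[≤] t₀, t₀ / 2 < t :=
      mem_nhdsWithin_of_mem_nhds (Ioi_mem_nhds (half_lt_self ht₀))
    filter_upwards [e1, e2, e3, eventually_mem_nhdsWithin] with t h1 h2 h3 ht
    rcases (mem_Iic.1 ht).eq_or_lt with heq | hlt
    · rw [heq, sub_self, FunctionSpaces.eHomBesovNorm_zero]; exact bot_le
    · have ht0 : 0 < t := (half_pos ht₀).trans h3
      rw [eHomBesovNorm_sub_comm]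
      refine (hrestart ht0 hlt).trans ?_
      simp only [Function.comp] at h2
      have h1' := h1 (V t) (hdom t h3.le hlt.le)
      -- the short piece with the worse constant `(t₀/2)^{-γ} ≥ t^{-γ}`
      have h2' : ENNReal.ofReal (K' * (a * b * t ^ (-γ)) * (t₀ - t) ^ γ) * Kd ≤ ε / 2 := by
        refine le_trans (mul_le_mul_left (ENNReal.ofReal_le_ofReal ?_) _) h2
        refine mul_le_mul_of_nonneg_right (mul_le_mul_of_nonneg_left
          (mul_le_mul_of_nonneg_left ?_ hab) hK'0) (Real.rpow_nonneg (sub_pos.2 hlt).le _)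
        exact Real.rpow_le_rpow_of_nonpos (half_pos ht₀) h3.le (by linarith)
      calc _ ≤ ε / 2 + ε / 2 := add_le_add h1' h2'
        _ = ε := ENNReal.add_halves ε
  rw [← nhdsLE_sup_nhdsGE, tendsto_sup]
  exact ⟨hleft, hright⟩

/-- **The Duhamel hypothesis `h5` of `exists_isBesovMildSolutionOn_of_duhamel`** (GKP 2016,
App. B; BCD, proof of Thm. 5.40): Besov regularity `Ḃ^{-1+3/p}_{p,1}` with the bound `C a b` and
time continuity on `(0, T)` of the Duhamel term of every jointly measurable Kato-class field on
`(0, T)` — from the global statement `exists_besov_duhamel_of_global_kato` applied to the time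
cut-off `1_{(-∞,T)}(t) u(t)`, which has the same Duhamel term on `(0, T]`. [cite: GKP2016, App. B] -/
theorem besov_duhamel_of_kato (hp₃ : 3 < p) (hp : p < ∞) :
    ∃ C : ℝ, 0 < C ∧ ∀ ⦃u : ℝ → ℝ³ → ℝ³⦄ ⦃T a b : ℝ⦄,
      Measurable (uncurry u) → 0 < T → 0 ≤ a → 0 ≤ b →
      (∀ t ∈ Ioo 0 T, eLpNorm (u t) p volume ≤
          ENNReal.ofReal (a * t ^ (-((1 - 3 / p.toReal) / 2)))) →
      (∀ t ∈ Ioo 0 T, ∀ x, ‖u t x‖ ≤ b * t ^ (-(1 / 2 : ℝ))) →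
        ∃ V : ℝ → 𝓢'(ℝ³, ℂ³),
          (∀ t ∈ Ioo 0 T, IsDistributionOf (kochTataruBilinear u u t) (V t)) ∧
          (∀ t ∈ Ioo 0 T, FunctionSpaces.eHomBesovNorm (-1 + 3 / p.toReal) p 1 (V t) ≤
              ENNReal.ofReal (C * a * b)) ∧
          ∀ t₀ ∈ Ioo 0 T, Tendsto
            (fun t => FunctionSpaces.eHomBesovNorm (-1 + 3 / p.toReal) p 1 (V t - V t₀))
            (𝓝[Ioo 0 T] t₀) (𝓝 0) := by
  obtain ⟨C, hC, h⟩ := exists_besov_duhamel_of_global_kato (p := p) hp₃ hp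
  refine ⟨C, hC, fun u T a b hum hT ha hb hLp hinf => ?_⟩
  -- the time cut-off
  set w : ℝ → ℝ³ → ℝ³ := (Iio T).indicator u with hw
  have hwm : Measurable (uncurry w) := measurable_uncurry_indicator_time hum measurableSet_Iio
  have hw_of_lt : ∀ t, t < T → w t = u t := fun t ht => by rw [hw, indicator_of_mem (mem_Iio.2 ht)]
  have hw_of_ge : ∀ t, T ≤ t → w t = 0 := fun t ht => by
    rw [hw, indicator_of_notMem (fun h : t ∈ Iio T => (not_le.2 (mem_Iio.1 h)) ht)]
  have hLpw : ∀ t, 0 < t → eLpNorm (w t) p volume ≤ ENNReal.ofReal (a * t ^ (-((1 - 3 / p.toReal) / 2))) := by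
    intro t ht
    rcases lt_or_ge t T with htT | htT
    · rw [hw_of_lt t htT]; exact hLp t ⟨ht, htT⟩
    · rw [hw_of_ge t htT, eLpNorm_zero]; exact bot_le
  have hinfw : ∀ t, 0 < t → ∀ x, ‖w t x‖ ≤ b * t ^ (-(1 / 2 : ℝ)) := by
    intro t ht x
    rcases lt_or_ge t T with htT | htT
    · rw [hw_of_lt t htT]; exact hinf t ⟨ht, htT⟩ x
    · rw [hw_of_ge t htT, Pi.zero_apply, norm_zero]; exact mul_nonneg hb (Real.rpow_nonneg ht.le _)
  -- the Duhamel terms agree on `(0, T]`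
  have hBw : ∀ t, t ≤ T → kochTataruBilinear w w t = kochTataruBilinear u u t := by
    intro t htT
    funext x
    simp only [kochTataruBilinear]
    refine setIntegral_congr_fun measurableSet_Ioo fun τ hτ => ?_
    simp only [hw_of_lt τ (hτ.2.trans_le htT)]
  obtain ⟨V, hVd, hVn, hVc⟩ := h hwm ha hb hLpw hinfw
  refine ⟨V, fun t ht => ?_, fun t ht => hVn t ht.1, fun t₀ ht₀ => ?_⟩
  · rw [← hBw t ht.2.le]; exact hVd t ht.1
  · exact tendsto_nhdsWithin_of_tendsto_nhds (hVc t₀ ht₀.1)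

/-- **BCD Theorem 5.40 holds**: `exists_isBesovMildSolutionOn` — local well-posedness of the
Navier–Stokes equations for divergence-free data in `Ḃ^{-1+3/p}_{p,q}(ℝ³)`, `3 < p, q < ∞`, with
a mild solution continuous in time with values in the Besov space — by the assembly
`exists_isBesovMildSolutionOn_of_duhamel` (Kato's fixed point in the `L^p`-weighted class, the
free evolution, the realisation dictionary) fed with the Duhamel regularity `besov_duhamel_of_kato`
proved here from the Littlewood–Paley analysis of the Oseen kernel (`OseenKernelBlocks`,
`BesovDuhamelBlocks`, `BesovDuhamelEstimates`). [cite: BahouriCheminDanchin2011, Thm. 5.40] -/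
theorem exists_isBesovMildSolutionOn_holds : exists_isBesovMildSolutionOn :=
  exists_isBesovMildSolutionOn_of_duhamel fun _p _ hp₃ hp => besov_duhamel_of_kato hp₃ hp

end Continuity

end Literature.Analysis.FluidPDE
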